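/-
Copyright (c) 2026 the pub-hodgecm-mathlib formalisation cell (harness21).  Prover seat hodgecm-mathlib-LH4-p07 (g8), req620 Track A «(D-RAM) FOUR-FRAME» squad
(STAGE-1b pre-scoping, heir LEAD F0P3a-plan (g20) T19-24 clause; dealer LH4-plan (g12) STATUS #18 board «p07 (g8): row-(2) type-(2) population»), 2026-09-04.
-/
import Summits.HodgeConjecture.HodgeConjecture.Theorems.F0P3cDyRamBlockGlueCount   -- ★ p857501 (LH4-p07 (g6)): O-GLUE COUNT; brings ★ p857479 `…BlockGluePlane` (plane glue data, (L5)(L6)), ★ p857312 glue fibration (general side condition `P`), ★ (z1-d) axis transport (`…_axis_lev_eq`), ★ T2c∕T2a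
import Literature.NumberTheory.Automorphic.UnitaryLatticeTreeBlockGlueLevel         -- ★ p858757 (this seat, (E1)): the level criterion in plane letters `forall_endoGL_sub_one_mulVec_mem_scaleLattice_iff_plane`, `sub_one_mulVec_sub_sub_one_smul`
import HarnessLib

/-!
# Crux `H413`, line LH4 «(D-RAM) FOUR-FRAME» — STAGE-1b, row (2): organ (C1-P) part 1 «O-GLUE COUNT WITH A LEVEL TOKEN»
# `#{M self-dual ∣ Γ·M = M, (Γ − 1)·M ⊆ c·M} = #{B₂ self-dual for H₂ ∣ γ₂B₂ = B₂, (γ₂ − 1)B₂ ⊆ cB₂} + Σ_{b=1}^{R} Σᶠ_{B₂ ∈ S_b^{c}(γ₂, u)} #fibre(ι_W B₂, b)`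

Cell `hodgecm-mathlib` (D-0151), FLOOR 0, crux item H413 = `stmt-HodgeConjecture-24833`, route of record `HCCMUnconditional`; squad F0∕P3c∕LH4; lane
`--supports stmt-HodgeConjecture-24833 --as helper` (count-neutral; pays NO tier-0 row; the STAGE-1b rows `stub_rows_transvPlus ∕ transvMinus ∕ regular` stay OPEN).
THEOREMS ONLY (no `def`, no instance, no notation, no `sorry`).  DATUM-FREE (`K` valued, `𝒪[K]` a PID, `σ` an isometric involution, `|ϖ| = exp(−1)`, block form with `H₂`
hermitian of unit determinant, `|h| = 1`; no `|2|`, no residue field).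

WHAT THIS IS.  ★ p857501 (`…BlockGlueCount`, this lineage g6) counts the `Γ`-FIXED self-dual lattices of a unitary block element `Γ = ι(γ₂, u)` through the plane:
`#F = #{B₂ ∣ SD_W, γ₂B₂ = B₂} + Σ_b Σᶠ_{B₂ ∈ S_b} #fibre`; it is link (L2) of the ★ (ρ2b′-X) chain whose M-letter form is ★ (C1) p857559.  The STAGE-1b profile pieces
`𝟙_{K_{a,b}}`, `𝟙{K ∧ X² ∈ ϖ^b M₃}` (★ p858649's reduction) see, on the type-(2) population, the `Γ`-fixed lattices that satisfy a LEVEL TOKEN `LEV_c(Γ, M) : (Γ − 1)·M ⊆ c·M`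
(`= LatticeInLevel ϖ a (Γ − 1) M` of ★ U2G DEFS at `c = ϖ^a`; ★ «S3-ram» spelling `M.map (Γ − 1) ≤ c·M`).  THIS FILE is ★ p857501 WITH THE TOKEN: by ★ p858757 (E1) the token
is a CELL-CONSTANT function of the plane glue data `(B₂, w₀)` — `LEV_c(Γ, M) ⟺ |u − 1| ≤ |c| ∧ LEV_c(γ₂, B₂) ∧ c⁻¹(γ₂w₀ − u·w₀) ∈ B₂` — so ★ p857501's «a cell is either
empty or a whole fibre» persists, the fibres (hence ★ T2b's norm-residue weights `#Sol_{2b}(r)`) are UNCHANGED, and only the INDEX SETS are cut: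
* axis: `{B₂ ∣ SD_W ∧ γ₂B₂ = B₂} ↦ {B₂ ∣ SD_W ∧ γ₂B₂ = B₂ ∧ LEV_c(γ₂, B₂)}` — ★ (z1-d) `ncard_selfDual_fixed_axis_lev_eq` VERBATIM;
* cone: `S_b ↦ S_b^{c}` = `S_b` with `LEV_c(γ₂, B₂)` added and the depth clause `γ₂w₀ − u·w₀ ∈ B₂` DEEPENED to `c⁻¹(γ₂w₀ − u·w₀) ∈ B₂` (it implies the old one).
In ★ (C1)'s M-letters (part 2, not here): `[IsOrd_j lam] ↦ [IsOrd_j ((lam − 1)∕c)]`, `levelSetDep (j, b; lam − jE u) ↦ levelSetDep (j, b; (lam − jE u)∕c)` — ONE multiplier at a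
shifted argument; the guard `|u − 1| ≤ |c|` is a condition on `γ_H` alone.
* §1 the token in the two spellings (`map ≤ scaleLattice` ↔ `∀ x, (Γ−1)x ∈ c·M`); the guard is NECESSARY (`lev_guard`).
* §2 (L5-c)∕(L6-c): a fixed member with the token has plane part in `S_b^{c}`; every member of a fibre over `S_b^{c}` is fixed and has the token (★ p857479 §2 glue data, ★
  `sub_smul_mem_iff_of_related` at `(c⁻¹(γ₂ − 1), c⁻¹(u − 1))` for the representative, ★ p858757 for the token, ★ (L5)(L6) for fixedness).
* §3 layer count with the token; §4 HEAD `ncard_fixed_selfDual_endoGL_lev_eq_axis_add_sum`.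
HONEST LABEL.  Count-neutral lattice bookkeeping; nothing printed is asserted; no census law is stated; `HC_CM` is proved only modulo the 7 printed citations (2 remaining named
inputs: hLiu418 = `stmt-HodgeConjecture-24832`, h413 = `stmt-HodgeConjecture-24833`) until rung 0 closes.

## References
* [BruhatTits1972] F. Bruhat, J. Tits, *Groupes réductifs sur un corps local I*, Publ. Math. IHÉS 41 (1972), §10 (lattice models of the rank-one building; tube layers; congruence filtrations).
* [Kottwitz1986BaseChangeUnits] R. E. Kottwitz, *Base change for unit elements of Hecke algebras*, Compositio Math. 60 (1986), §1 pp. 240–241 (orbital integrals of units as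
  fixed-lattice counts; lattices as `𝒪[γ]`-modules).
* [Jacobowitz1962] R. Jacobowitz, *Hermitian forms over local fields*, Amer. J. Math. 84 (1962), §4 (dual lattices, gluing of modular components).
* [Rogawski1990] J. D. Rogawski, *Automorphic Representations of Unitary Groups in Three Variables*, Ann. of Math. Stud. 123 (1990), §4.8 Case (a) p. 53, §4.9 p. 55.
-/

set_option autoImplicit false

noncomputable section

namespace Summit.HodgeConjecture.HodgeConjecture.Cruxes.H413.F0P3cDyRamBlockGlueLevelCount

open scoped Valued WithZero Matrix MatrixGroups
open Literature.NumberTheory.Automorphic Literature.NumberTheory.Automorphic.HermitianLattice Literature.NumberTheory.Automorphic.UnitaryLatticeTree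
open Literature.NumberTheory.Rogawski1990
open Summit.HodgeConjecture.HodgeConjecture.Cruxes.H413.F0P3cDyRamBlockGluePlane
open Summit.HodgeConjecture.HodgeConjecture.Cruxes.H413.F0P3cDyRamBlockGlueCount

variable {K : Type*} [Field K] [Valued K ℤᵐ⁰]

/-! ## §1 The level token in its two spellings; the guard -/

/-- `M.map X ≤ c·M ⟺ ∀ x ∈ M, X·x ∈ c·M` (the ★ «S3-ram» ∕ `LatticeInLevel` spelling vs the ★ (E1) spelling). [cite: BruhatTits1972, §10] -/
theorem map_toLin'_le_scaleLattice_iff_forall_mulVec_mem (X : Matrix (Fin 3) (Fin 3) K) (c : K) (M : Submodule 𝒪[K] (Fin 3 → K)) :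
    M.map ((Matrix.toLin' X).restrictScalars 𝒪[K]) ≤ scaleLattice c M ↔ ∀ x ∈ M, X *ᵥ x ∈ scaleLattice c M := by
  rw [Submodule.map_le_iff_le_comap]
  refine forall₂_congr fun x _ => ?_
  rw [Submodule.mem_comap, LinearMap.restrictScalars_apply, Matrix.toLin'_apply]

/-- The same on the plane. [cite: BruhatTits1972, §10] -/
theorem map_toLin'_le_scaleLattice_iff_forall_mulVec_mem₂ (X : Matrix (Fin 2) (Fin 2) K) (c : K) (B : Submodule 𝒪[K] (Fin 2 → K)) :
    B.map ((Matrix.toLin' X).restrictScalars 𝒪[K]) ≤ scaleLattice c B ↔ ∀ y ∈ B, X *ᵥ y ∈ scaleLattice c B := by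
  rw [Submodule.map_le_iff_le_comap]
  refine forall₂_congr fun y _ => ?_
  rw [Submodule.mem_comap, LinearMap.restrictScalars_apply, Matrix.toLin'_apply]

/-- **THE GUARD IS NECESSARY**: for a self-dual `M` (block form, `det H₂` a unit, `|h| = 1`) and `c ≠ 0`, `(Γ − 1)·M ⊆ c·M` forces `|u − 1| ≤ |c|` — on the axis by ★ (E1)
`forall_mulVec_mem_scaleLattice_iff_of_single_one_mem`, on the glue fibre by ★ (E1) `forall_mulVec_mem_scaleLattice_iff_inf_ker` (★ (c3-i)). [cite: Kottwitz1986BaseChangeUnits, §1 pp. 240–241] [cite: BruhatTits1972, §10] -/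
theorem lev_guard (σ : K →+* K) (hvσ : ∀ a, Valued.v (σ a) = Valued.v a) {ϖ : K} (hϖ : Valued.v ϖ = WithZero.exp (-1 : ℤ))
    {H₂ : Matrix (Fin 2) (Fin 2) K} (hH₂ : IsUnit H₂.det) {h : K} (hh : Valued.v h = 1)
    {M : Submodule 𝒪[K] (Fin 3 → K)} (hM : IsSelfDualLattice σ ϖ (!![H₂ 0 0, 0, H₂ 0 1; 0, h, 0; H₂ 1 0, 0, H₂ 1 1] : Matrix (Fin 3) (Fin 3) K) M)
    (γ₂ : GL (Fin 2) K) (u : GL (Fin 1) K) {c : K} (hc : c ≠ 0)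
    (hlev : ∀ x ∈ M, (((endoGL (γ₂, u) : GL (Fin 3) K) : Matrix (Fin 3) (Fin 3) K) - 1) *ᵥ x ∈ scaleLattice c M) :
    Valued.v ((u : Matrix (Fin 1) (Fin 1) K) 0 0 - 1) ≤ Valued.v c := by
  obtain ⟨b, hb, hpr, x₀, hx₀, hx₀1⟩ := exists_tubeCoordinate σ hvσ hϖ hH₂ hh hM
  have h1 := ((forall_mulVec_mem_scaleLattice_iff_inf_ker hϖ (endoGL_sub_one_col γ₂ u) (endoGL_sub_one_row γ₂ u) hc hb hpr hx₀ hx₀1).1 hlev).1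
  rwa [endoGL_sub_one_apply_one_one] at h1

/-! ## §2 (L5-c)∕(L6-c): the cut cone index set `S_b^{c}` -/

/-- **(L5-c) A FIXED MEMBER WITH THE LEVEL TOKEN HAS ITS PLANE PART IN THE CUT INDEX SET `S_b^{c}(γ₂, u)`.**  If `M` is self-dual with tube coordinate `b ≥ 1`, `Γ·M = M`
(`Γ = ι(γ₂, u)` unitary, `|u| = 1`) and `(Γ − 1)·M ⊆ c·M` (`c ≠ 0`), then `ι_W⁻¹(M ∩ W)` is a `γ₂`-fixed plane lattice with `(γ₂ − 1)B₂ ⊆ c·B₂` carrying a glue representative `w₀`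
with (G1), (gen), (norm) and the DEEP depth clause `c⁻¹(γ₂w₀ − u·w₀) ∈ B₂` (★ p857479 §2 + ★ (L5) + ★ (E1)).
[cite: Kottwitz1986BaseChangeUnits, §1 pp. 240–241] [cite: BruhatTits1972, §10] [cite: Jacobowitz1962, §4] -/
theorem comap_planeMatrix_mem_levConeIndex [IsPrincipalIdealRing 𝒪[K]] (σ : K →+* K) (hσ : ∀ a, σ (σ a) = a)
    (hvσ : ∀ a, Valued.v (σ a) = Valued.v a) {ϖ : K} (hϖ : Valued.v ϖ = WithZero.exp (-1 : ℤ))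
    {H₂ : Matrix (Fin 2) (Fin 2) K} (hH₂ : IsUnit H₂.det) (hH₂σ : (H₂.map σ)ᵀ = H₂) {h : K} (hh : Valued.v h = 1)
    {M : Submodule 𝒪[K] (Fin 3 → K)} (hM : IsSelfDualLattice σ ϖ (!![H₂ 0 0, 0, H₂ 0 1; 0, h, 0; H₂ 1 0, 0, H₂ 1 1] : Matrix (Fin 3) (Fin 3) K) M)
    {b : ℕ} (hb1 : 1 ≤ b) (hb : ∀ a : K, (Pi.single 1 a : Fin 3 → K) ∈ M ↔ Valued.v a ≤ Valued.v ϖ ^ b)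
    (γ₂ : GL (Fin 2) K) (u : GL (Fin 1) K) (hΓ : endoGL (γ₂, u) ∈ unitaryGroupOfForm σ (!![H₂ 0 0, 0, H₂ 0 1; 0, h, 0; H₂ 1 0, 0, H₂ 1 1] : Matrix (Fin 3) (Fin 3) K))
    (hu : Valued.v ((u : Matrix (Fin 1) (Fin 1) K) 0 0) = 1) {c : K} (hc : c ≠ 0) (hfix : mapGL (endoGL (γ₂, u)) M = M)
    (hlev : ∀ x ∈ M, (((endoGL (γ₂, u) : GL (Fin 3) K) : Matrix (Fin 3) (Fin 3) K) - 1) *ᵥ x ∈ scaleLattice c M) :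
    (M ⊓ LinearMap.ker ((LinearMap.proj (1 : Fin 3) : (Fin 3 → K) →ₗ[K] K).restrictScalars 𝒪[K])).comap
        ((Matrix.toLin' (!![1, 0; 0, 0; 0, 1] : Matrix (Fin 3) (Fin 2) K)).restrictScalars 𝒪[K]) ∈
      {B : Submodule 𝒪[K] (Fin 2 → K) | (∃ g : GL (Fin 2) K, B = latt (g : Matrix (Fin 2) (Fin 2) K)) ∧ mapGL γ₂ B = B ∧
          (∀ y ∈ B, c⁻¹ • (((γ₂ : Matrix (Fin 2) (Fin 2) K) - 1) *ᵥ y) ∈ B) ∧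
          ∃ w₀ : Fin 2 → K, (∀ w, w ∈ B ↔ (w ∈ dualLatt σ H₂ B ∧ Valued.v (pairing σ H₂ w₀ w) ≤ 1)) ∧
            (∀ w ∈ dualLatt σ H₂ B, ∃ (t : K) (a : Fin 2 → K), Valued.v t ≤ 1 ∧ a ∈ B ∧ w = t • w₀ + a) ∧
            Valued.v (pairing σ H₂ w₀ w₀) * Valued.v ϖ ^ (2 * b) = 1 ∧
            c⁻¹ • ((γ₂ : Matrix (Fin 2) (Fin 2) K).mulVec w₀ - (u : Matrix (Fin 1) (Fin 1) K) 0 0 • w₀) ∈ B} := by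
  obtain ⟨B₂, w₀, x₀, hg, hB, hx₀, hx₀1, hpr, hG1, hgen, hnorm⟩ := exists_planeGlueData σ hσ hvσ hϖ hH₂ hH₂σ hh hM hb1 hb
  have hcomap : (M ⊓ LinearMap.ker ((LinearMap.proj (1 : Fin 3) : (Fin 3 → K) →ₗ[K] K).restrictScalars 𝒪[K])).comap
      ((Matrix.toLin' (!![1, 0; 0, 0; 0, 1] : Matrix (Fin 3) (Fin 2) K)).restrictScalars 𝒪[K]) = B₂ := by
    rw [← hB, Submodule.comap_map_eq_of_injective planeMatrix_injective]
  obtain ⟨hγB, -⟩ := (mapGL_endoGL_eq_iff_plane σ hvσ hϖ hH₂ hh hM hb1 hb hg hB hx₀ hx₀1 hpr γ₂ u hΓ hu).1 hfix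
  -- the slope bound of the tube coordinate, then ★ (E1)
  obtain ⟨b', hb', hslope, -⟩ := exists_tubeCoordinate σ hvσ hϖ hH₂ hh hM
  obtain ⟨hbb, -⟩ := tubeCoordinate_unique hϖ hb hb'
  subst hbb
  obtain ⟨-, hW, hdeep⟩ := (forall_endoGL_sub_one_mulVec_mem_scaleLattice_iff_plane hϖ hc hb hslope hB hx₀ hx₀1 hpr γ₂ u).1 hlev
  rw [hcomap]
  exact ⟨hg, hγB, hW, w₀, hG1, hgen, hnorm, hdeep⟩

/-- **(L6-c) EVERY MEMBER OF A FIBRE OVER THE CUT INDEX SET IS FIXED AND HAS THE LEVEL TOKEN** (the gluing digit never enters): if `M` is self-dual with tube coordinate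
`b ≥ 1`, `ι_W⁻¹(M ∩ W) ∈ S_b^{c}(γ₂, u)`, the guard `|u − 1| ≤ |c|` holds and `|c| ≤ 1` (`c = ϖ^a`), then `Γ·M = M` and `(Γ − 1)·M ⊆ c·M` (fixedness: the deep clause implies
★ (L6)'s clause since `c` is integral; token: ★ p857479 §2 glue data, ★ `sub_smul_mem_iff_of_related` at `(c⁻¹(γ₂ − 1), c⁻¹(u − 1))` to move the deep clause to `M`'s own
representative, then ★ (E1)). [cite: Kottwitz1986BaseChangeUnits, §1 pp. 240–241] [cite: BruhatTits1972, §10] [cite: Jacobowitz1962, §4] -/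
theorem mapGL_eq_and_lev_of_comap_planeMatrix_mem_levConeIndex [IsPrincipalIdealRing 𝒪[K]] (σ : K →+* K) (hσ : ∀ a, σ (σ a) = a)
    (hvσ : ∀ a, Valued.v (σ a) = Valued.v a) {ϖ : K} (hϖ : Valued.v ϖ = WithZero.exp (-1 : ℤ))
    {H₂ : Matrix (Fin 2) (Fin 2) K} (hH₂ : IsUnit H₂.det) (hH₂σ : (H₂.map σ)ᵀ = H₂) {h : K} (hh : Valued.v h = 1)
    {M : Submodule 𝒪[K] (Fin 3 → K)} (hM : IsSelfDualLattice σ ϖ (!![H₂ 0 0, 0, H₂ 0 1; 0, h, 0; H₂ 1 0, 0, H₂ 1 1] : Matrix (Fin 3) (Fin 3) K) M)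
    {b : ℕ} (hb1 : 1 ≤ b) (hb : ∀ a : K, (Pi.single 1 a : Fin 3 → K) ∈ M ↔ Valued.v a ≤ Valued.v ϖ ^ b)
    (γ₂ : GL (Fin 2) K) (u : GL (Fin 1) K) (hΓ : endoGL (γ₂, u) ∈ unitaryGroupOfForm σ (!![H₂ 0 0, 0, H₂ 0 1; 0, h, 0; H₂ 1 0, 0, H₂ 1 1] : Matrix (Fin 3) (Fin 3) K))
    (hu : Valued.v ((u : Matrix (Fin 1) (Fin 1) K) 0 0) = 1) {c : K} (hc : c ≠ 0) (hc1 : Valued.v c ≤ 1) (huc : Valued.v ((u : Matrix (Fin 1) (Fin 1) K) 0 0 - 1) ≤ Valued.v c)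
    (hS : (M ⊓ LinearMap.ker ((LinearMap.proj (1 : Fin 3) : (Fin 3 → K) →ₗ[K] K).restrictScalars 𝒪[K])).comap
        ((Matrix.toLin' (!![1, 0; 0, 0; 0, 1] : Matrix (Fin 3) (Fin 2) K)).restrictScalars 𝒪[K]) ∈
      {B : Submodule 𝒪[K] (Fin 2 → K) | (∃ g : GL (Fin 2) K, B = latt (g : Matrix (Fin 2) (Fin 2) K)) ∧ mapGL γ₂ B = B ∧
          (∀ y ∈ B, c⁻¹ • (((γ₂ : Matrix (Fin 2) (Fin 2) K) - 1) *ᵥ y) ∈ B) ∧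
          ∃ w₀ : Fin 2 → K, (∀ w, w ∈ B ↔ (w ∈ dualLatt σ H₂ B ∧ Valued.v (pairing σ H₂ w₀ w) ≤ 1)) ∧
            (∀ w ∈ dualLatt σ H₂ B, ∃ (t : K) (a : Fin 2 → K), Valued.v t ≤ 1 ∧ a ∈ B ∧ w = t • w₀ + a) ∧
            Valued.v (pairing σ H₂ w₀ w₀) * Valued.v ϖ ^ (2 * b) = 1 ∧
            c⁻¹ • ((γ₂ : Matrix (Fin 2) (Fin 2) K).mulVec w₀ - (u : Matrix (Fin 1) (Fin 1) K) 0 0 • w₀) ∈ B}) :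
    mapGL (endoGL (γ₂, u)) M = M ∧ ∀ x ∈ M, (((endoGL (γ₂, u) : GL (Fin 3) K) : Matrix (Fin 3) (Fin 3) K) - 1) *ᵥ x ∈ scaleLattice c M := by
  obtain ⟨B₂, w₀', x₀, hg, hB, hx₀, hx₀1, hpr, hG1', hgen', -⟩ := exists_planeGlueData σ hσ hvσ hϖ hH₂ hH₂σ hh hM hb1 hb
  have hcomap : (M ⊓ LinearMap.ker ((LinearMap.proj (1 : Fin 3) : (Fin 3 → K) →ₗ[K] K).restrictScalars 𝒪[K])).comap
      ((Matrix.toLin' (!![1, 0; 0, 0; 0, 1] : Matrix (Fin 3) (Fin 2) K)).restrictScalars 𝒪[K]) = B₂ := by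
    rw [← hB, Submodule.comap_map_eq_of_injective planeMatrix_injective]
  rw [hcomap] at hS
  obtain ⟨hg'', hγB, hW, w₀, hG1, hgen, hnorm, hdeep⟩ := hS
  -- fixedness: the deep clause gives ★ (L6)'s clause because `c` is integral
  have hplain : (γ₂ : Matrix (Fin 2) (Fin 2) K).mulVec w₀ - (u : Matrix (Fin 1) (Fin 1) K) 0 0 • w₀ ∈ B₂ := by
    have h1 := B₂.smul_mem (⟨c, hc1⟩ : 𝒪[K]) hdeep
    have e : ((⟨c, hc1⟩ : 𝒪[K]) • (c⁻¹ • ((γ₂ : Matrix (Fin 2) (Fin 2) K).mulVec w₀ - (u : Matrix (Fin 1) (Fin 1) K) 0 0 • w₀)) : Fin 2 → K) =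
        (γ₂ : Matrix (Fin 2) (Fin 2) K).mulVec w₀ - (u : Matrix (Fin 1) (Fin 1) K) 0 0 • w₀ := by
      rw [Subring.smul_def]
      exact smul_inv_smul₀ hc _
    rwa [e] at h1
  have hSb : (M ⊓ LinearMap.ker ((LinearMap.proj (1 : Fin 3) : (Fin 3 → K) →ₗ[K] K).restrictScalars 𝒪[K])).comap
        ((Matrix.toLin' (!![1, 0; 0, 0; 0, 1] : Matrix (Fin 3) (Fin 2) K)).restrictScalars 𝒪[K]) ∈
      {B : Submodule 𝒪[K] (Fin 2 → K) | (∃ g : GL (Fin 2) K, B = latt (g : Matrix (Fin 2) (Fin 2) K)) ∧ mapGL γ₂ B = B ∧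
          ∃ w₀ : Fin 2 → K, (∀ w, w ∈ B ↔ (w ∈ dualLatt σ H₂ B ∧ Valued.v (pairing σ H₂ w₀ w) ≤ 1)) ∧
            (∀ w ∈ dualLatt σ H₂ B, ∃ (t : K) (a : Fin 2 → K), Valued.v t ≤ 1 ∧ a ∈ B ∧ w = t • w₀ + a) ∧
            Valued.v (pairing σ H₂ w₀ w₀) * Valued.v ϖ ^ (2 * b) = 1 ∧
            (γ₂ : Matrix (Fin 2) (Fin 2) K).mulVec w₀ - (u : Matrix (Fin 1) (Fin 1) K) 0 0 • w₀ ∈ B} := by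
    rw [hcomap]
    exact ⟨hg'', hγB, w₀, hG1, hgen, hnorm, hplain⟩
  refine ⟨mapGL_eq_of_comap_planeMatrix_mem_coneIndex σ hσ hvσ hϖ hH₂ hH₂σ hh hM hb1 hb γ₂ u hΓ hu hSb, ?_⟩
  -- the token: move the deep clause to `M`'s own representative `w₀'`, then ★ (E1)
  have hH₂h : ∀ a d : Fin 2, σ (H₂ a d) = H₂ d a := fun a d => by
    have e := congrFun (congrFun hH₂σ d) a
    rwa [Matrix.transpose_apply, Matrix.map_apply] at e
  have hsymm₂ : ∀ x y : Fin 2 → K, Valued.v (pairing σ H₂ y x) = Valued.v (pairing σ H₂ x y) := v_pairing_comm_of_hermitian hvσ hσ hH₂h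
  have hw₀'d : w₀' ∈ dualLatt σ H₂ B₂ := fun y hy => by rw [hsymm₂]; exact ((hG1' y).1 hy).2
  have hw₀d : w₀ ∈ dualLatt σ H₂ B₂ := fun y hy => by rw [hsymm₂]; exact ((hG1 y).1 hy).2
  have hst' : ∀ y ∈ B₂, (c⁻¹ • ((γ₂ : Matrix (Fin 2) (Fin 2) K) - 1)) *ᵥ y ∈ B₂ := fun y hy => by
    rw [Matrix.smul_mulVec]; exact hW y hy
  have hu' : Valued.v (c⁻¹ * ((u : Matrix (Fin 1) (Fin 1) K) 0 0 - 1)) ≤ 1 := by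
    have hvc : 0 < Valued.v c := zero_lt_iff.2 ((Valuation.ne_zero_iff _).2 hc)
    rw [map_mul, map_inv₀, ← div_eq_inv_mul, div_le_one₀ hvc]; exact huc
  have e : ∀ w : Fin 2 → K, (c⁻¹ • ((γ₂ : Matrix (Fin 2) (Fin 2) K) - 1)) *ᵥ w - (c⁻¹ * ((u : Matrix (Fin 1) (Fin 1) K) 0 0 - 1)) • w =
      c⁻¹ • ((γ₂ : Matrix (Fin 2) (Fin 2) K) *ᵥ w - (u : Matrix (Fin 1) (Fin 1) K) 0 0 • w) := fun w => by
    rw [Matrix.smul_mulVec, mul_smul, ← smul_sub, sub_one_mulVec_sub_sub_one_smul]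
  have hdeep' : c⁻¹ • ((γ₂ : Matrix (Fin 2) (Fin 2) K) *ᵥ w₀' - (u : Matrix (Fin 1) (Fin 1) K) 0 0 • w₀') ∈ B₂ := by
    have h1 := (sub_smul_mem_iff_of_related hst' hu' (hgen _ hw₀'d) (hgen' _ hw₀d)).1 (by rw [e]; exact hdeep)
    rwa [e] at h1
  obtain ⟨b', hb', hslope, -⟩ := exists_tubeCoordinate σ hvσ hϖ hH₂ hh hM
  obtain ⟨hbb, -⟩ := tubeCoordinate_unique hϖ hb hb'
  subst hbb
  exact (forall_endoGL_sub_one_mulVec_mem_scaleLattice_iff_plane hϖ hc hb hslope hB hx₀ hx₀1 hpr γ₂ u).2 ⟨huc, hW, hdeep'⟩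

/-! ## §3 The tube layer `b ≥ 1` with the level token -/

/-- **LAYER COUNT WITH THE LEVEL TOKEN.**  For a UNITARY block element `Γ = ι(γ₂, u)` whose fixed self-dual family is finite, `c ≠ 0` with `|c| ≤ 1` and the guard
`|u − 1| ≤ |c|`, and `b ≥ 1`:  `Σᶠ_B #{M self-dual ∣ Γ·M = M, (Γ − 1)·M ⊆ c·M, tube b, M ∩ W = B} = Σᶠ_{B₂ ∈ S_b^{c}} #{M self-dual ∣ M ∩ W = ι_W B₂, tube b}`
(★ p857501 §5's regrouping with §2 in place of ★ (L5)(L6)); the summand is ★ T2b's glue fibre, UNCHANGED. [cite: BruhatTits1972, §10] [cite: Kottwitz1986BaseChangeUnits, §1 pp. 240–241] [cite: Jacobowitz1962, §4] -/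
theorem finsum_ncard_levGlueCell_eq_finsum_mem_ncard_glueFibre [IsPrincipalIdealRing 𝒪[K]] (σ : K →+* K) (hσ : ∀ a, σ (σ a) = a)
    (hvσ : ∀ a, Valued.v (σ a) = Valued.v a) {ϖ : K} (hϖ : Valued.v ϖ = WithZero.exp (-1 : ℤ))
    {H₂ : Matrix (Fin 2) (Fin 2) K} (hH₂ : IsUnit H₂.det) (hH₂σ : (H₂.map σ)ᵀ = H₂) {h : K} (hh : Valued.v h = 1)
    (γ₂ : GL (Fin 2) K) (u : GL (Fin 1) K) (hΓ : endoGL (γ₂, u) ∈ unitaryGroupOfForm σ (!![H₂ 0 0, 0, H₂ 0 1; 0, h, 0; H₂ 1 0, 0, H₂ 1 1] : Matrix (Fin 3) (Fin 3) K))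
    (hu : Valued.v ((u : Matrix (Fin 1) (Fin 1) K) 0 0) = 1) {c : K} (hc : c ≠ 0) (hc1 : Valued.v c ≤ 1) (huc : Valued.v ((u : Matrix (Fin 1) (Fin 1) K) 0 0 - 1) ≤ Valued.v c)
    (hfin : {M : Submodule 𝒪[K] (Fin 3 → K) |
      IsSelfDualLattice σ ϖ (!![H₂ 0 0, 0, H₂ 0 1; 0, h, 0; H₂ 1 0, 0, H₂ 1 1] : Matrix (Fin 3) (Fin 3) K) M ∧ mapGL (endoGL (γ₂, u)) M = M}.Finite)
    {b : ℕ} (hb1 : 1 ≤ b) :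
    ∑ᶠ B : Submodule 𝒪[K] (Fin 3 → K),
        {M : Submodule 𝒪[K] (Fin 3 → K) |
          (IsSelfDualLattice σ ϖ (!![H₂ 0 0, 0, H₂ 0 1; 0, h, 0; H₂ 1 0, 0, H₂ 1 1] : Matrix (Fin 3) (Fin 3) K) M ∧
              (mapGL (endoGL (γ₂, u)) M = M ∧ ∀ x ∈ M, (((endoGL (γ₂, u) : GL (Fin 3) K) : Matrix (Fin 3) (Fin 3) K) - 1) *ᵥ x ∈ scaleLattice c M)) ∧
            (∀ a : K, (Pi.single 1 a : Fin 3 → K) ∈ M ↔ Valued.v a ≤ Valued.v ϖ ^ b) ∧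
            M ⊓ LinearMap.ker ((LinearMap.proj (1 : Fin 3) : (Fin 3 → K) →ₗ[K] K).restrictScalars 𝒪[K]) = B}.ncard =
      ∑ᶠ B₂ ∈ {B : Submodule 𝒪[K] (Fin 2 → K) | (∃ g : GL (Fin 2) K, B = latt (g : Matrix (Fin 2) (Fin 2) K)) ∧ mapGL γ₂ B = B ∧
          (∀ y ∈ B, c⁻¹ • (((γ₂ : Matrix (Fin 2) (Fin 2) K) - 1) *ᵥ y) ∈ B) ∧
          ∃ w₀ : Fin 2 → K, (∀ w, w ∈ B ↔ (w ∈ dualLatt σ H₂ B ∧ Valued.v (pairing σ H₂ w₀ w) ≤ 1)) ∧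
            (∀ w ∈ dualLatt σ H₂ B, ∃ (t : K) (a : Fin 2 → K), Valued.v t ≤ 1 ∧ a ∈ B ∧ w = t • w₀ + a) ∧
            Valued.v (pairing σ H₂ w₀ w₀) * Valued.v ϖ ^ (2 * b) = 1 ∧
            c⁻¹ • ((γ₂ : Matrix (Fin 2) (Fin 2) K).mulVec w₀ - (u : Matrix (Fin 1) (Fin 1) K) 0 0 • w₀) ∈ B},
        {M : Submodule 𝒪[K] (Fin 3 → K) | IsSelfDualLattice σ ϖ (!![H₂ 0 0, 0, H₂ 0 1; 0, h, 0; H₂ 1 0, 0, H₂ 1 1] : Matrix (Fin 3) (Fin 3) K) M ∧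
            M ⊓ LinearMap.ker ((LinearMap.proj (1 : Fin 3) : (Fin 3 → K) →ₗ[K] K).restrictScalars 𝒪[K]) =
              B₂.map ((Matrix.toLin' (!![1, 0; 0, 0; 0, 1] : Matrix (Fin 3) (Fin 2) K)).restrictScalars 𝒪[K]) ∧
            ∀ a : K, (Pi.single 1 a : Fin 3 → K) ∈ M ↔ Valued.v a ≤ Valued.v ϖ ^ b}.ncard := by
  classical
  set H : Matrix (Fin 3) (Fin 3) K := !![H₂ 0 0, 0, H₂ 0 1; 0, h, 0; H₂ 1 0, 0, H₂ 1 1] with hHdef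
  set Wk : Submodule 𝒪[K] (Fin 3 → K) := LinearMap.ker ((LinearMap.proj (1 : Fin 3) : (Fin 3 → K) →ₗ[K] K).restrictScalars 𝒪[K]) with hWk
  set ι := ((Matrix.toLin' (!![1, 0; 0, 0; 0, 1] : Matrix (Fin 3) (Fin 2) K)).restrictScalars 𝒪[K]) with hι
  set S : Set (Submodule 𝒪[K] (Fin 2 → K)) := {B : Submodule 𝒪[K] (Fin 2 → K) | (∃ g : GL (Fin 2) K, B = latt (g : Matrix (Fin 2) (Fin 2) K)) ∧ mapGL γ₂ B = B ∧
          (∀ y ∈ B, c⁻¹ • (((γ₂ : Matrix (Fin 2) (Fin 2) K) - 1) *ᵥ y) ∈ B) ∧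
          ∃ w₀ : Fin 2 → K, (∀ w, w ∈ B ↔ (w ∈ dualLatt σ H₂ B ∧ Valued.v (pairing σ H₂ w₀ w) ≤ 1)) ∧
            (∀ w ∈ dualLatt σ H₂ B, ∃ (t : K) (a : Fin 2 → K), Valued.v t ≤ 1 ∧ a ∈ B ∧ w = t • w₀ + a) ∧
            Valued.v (pairing σ H₂ w₀ w₀) * Valued.v ϖ ^ (2 * b) = 1 ∧
            c⁻¹ • ((γ₂ : Matrix (Fin 2) (Fin 2) K).mulVec w₀ - (u : Matrix (Fin 1) (Fin 1) K) 0 0 • w₀) ∈ B} with hSdef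
  -- the tube layer `b` of the fixed-with-token family
  set L : Set (Submodule 𝒪[K] (Fin 3 → K)) := {M | (IsSelfDualLattice σ ϖ H M ∧
      (mapGL (endoGL (γ₂, u)) M = M ∧ ∀ x ∈ M, (((endoGL (γ₂, u) : GL (Fin 3) K) : Matrix (Fin 3) (Fin 3) K) - 1) *ᵥ x ∈ scaleLattice c M)) ∧
      ∀ a : K, (Pi.single 1 a : Fin 3 → K) ∈ M ↔ Valued.v a ≤ Valued.v ϖ ^ b} with hL
  have hLfin : L.Finite := hfin.subset fun M hM => ⟨hM.1.1, hM.1.2.1⟩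
  have h1 : (∑ᶠ B : Submodule 𝒪[K] (Fin 3 → K), {M : Submodule 𝒪[K] (Fin 3 → K) | (IsSelfDualLattice σ ϖ H M ∧
      (mapGL (endoGL (γ₂, u)) M = M ∧ ∀ x ∈ M, (((endoGL (γ₂, u) : GL (Fin 3) K) : Matrix (Fin 3) (Fin 3) K) - 1) *ᵥ x ∈ scaleLattice c M)) ∧
      (∀ a : K, (Pi.single 1 a : Fin 3 → K) ∈ M ↔ Valued.v a ≤ Valued.v ϖ ^ b) ∧ M ⊓ Wk = B}.ncard) = L.ncard := by
    rw [ncard_eq_finsum_ncard_fiber L hLfin fun M => M ⊓ Wk]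
    refine finsum_congr fun B => ?_
    congr 1
    ext M
    simp only [hL, Set.mem_setOf_eq, and_assoc]
  rw [h1, ncard_eq_finsum_ncard_fiber L hLfin fun M => (M ⊓ Wk).comap ι, finsum_mem_def]
  refine finsum_congr fun B₂ => ?_
  by_cases hS : B₂ ∈ S
  · rw [Set.indicator_of_mem hS]
    congr 1
    ext M
    simp only [hL, Set.mem_setOf_eq]
    constructor
    · rintro ⟨⟨⟨hSD, -⟩, htube⟩, hκ⟩
      refine ⟨hSD, ?_, htube⟩
      rw [← hκ, map_comap_planeMatrix_inf_ker]
    · rintro ⟨hSD, hW, htube⟩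
      have hκ : (M ⊓ Wk).comap ι = B₂ := by rw [hW, Submodule.comap_map_eq_of_injective planeMatrix_injective]
      have hS' := hS
      rw [← hκ] at hS'
      exact ⟨⟨⟨hSD, mapGL_eq_and_lev_of_comap_planeMatrix_mem_levConeIndex σ hσ hvσ hϖ hH₂ hH₂σ hh hSD hb1 htube γ₂ u hΓ hu hc hc1 huc hS'⟩, htube⟩, hκ⟩
  · rw [Set.indicator_of_notMem hS]
    have hempty : {M : Submodule 𝒪[K] (Fin 3 → K) | M ∈ L ∧ (M ⊓ Wk).comap ι = B₂} = ∅ := by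
      ext M
      simp only [hL, Set.mem_setOf_eq, Set.mem_empty_iff_false, iff_false]
      rintro ⟨⟨⟨hSD, hfix, hlev⟩, htube⟩, hκ⟩
      have hmem := comap_planeMatrix_mem_levConeIndex σ hσ hvσ hϖ hH₂ hH₂σ hh hSD hb1 htube γ₂ u hΓ hu hc hfix hlev
      rw [hκ] at hmem
      exact hS hmem
    rw [hempty, Set.ncard_empty]

/-! ## §4 HEAD — the fixed self-dual lattices WITH A LEVEL TOKEN, counted through the plane -/

/-- **(C1-P) PART 1 — O-GLUE COUNT WITH A LEVEL TOKEN (HEAD).**  Block form `H` (`σ` an isometric involution, `H₂` hermitian with unit determinant, `|h| = 1`, `𝒪` a PID),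
`Γ = endoGL (γ₂, u)` UNITARY for `H` with finite fixed self-dual family of tube coordinates `≤ R`; `c ≠ 0`, `|c| ≤ 1`, guard `|u − 1| ≤ |c|`.  Then, in the `LatticeInLevel` ∕ ★
«S3-ram» spelling `M.map (Γ − 1) ≤ c·M` of the token:
`#{M ∣ SD, Γ·M = M, (Γ − 1)·M ⊆ c·M} = #{B₂ ∣ SD_W, γ₂B₂ = B₂, (γ₂ − 1)B₂ ⊆ c·B₂} + Σ_{b ∈ [1, R]} Σᶠ_{B₂ ∈ S_b^{c}} #{M ∣ SD, M ∩ W = ι_W B₂, tube b}`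
— ★ p857312 (general side condition) ⊕ ★ (z1-d) `ncard_selfDual_fixed_axis_lev_eq` ⊕ §3.  The summands are ★ T2b's glue fibres (`= #Sol_{2b}(r_{B₂})` at any admissible
`w₀`), exactly as in ★ p857501; only the index sets carry the token.  Part 2 (M-letters, ★ (C1)'s order form with `levelSetDep (j, b; (lam − jE u)∕c)`) is the sequel.
[cite: Kottwitz1986BaseChangeUnits, §1 pp. 240–241] [cite: BruhatTits1972, §10] [cite: Jacobowitz1962, §4] [cite: Rogawski1990, §4.9 p. 55] -/
theorem ncard_fixed_selfDual_endoGL_lev_eq_axis_add_sum [IsPrincipalIdealRing 𝒪[K]] (σ : K →+* K) (hσ : ∀ a, σ (σ a) = a)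
    (hvσ : ∀ a, Valued.v (σ a) = Valued.v a) {ϖ : K} (hϖ : Valued.v ϖ = WithZero.exp (-1 : ℤ))
    {H₂ : Matrix (Fin 2) (Fin 2) K} (hH₂ : IsUnit H₂.det) (hH₂σ : (H₂.map σ)ᵀ = H₂) {h : K} (hh : Valued.v h = 1)
    (γ₂ : GL (Fin 2) K) (u : GL (Fin 1) K) (hΓ : endoGL (γ₂, u) ∈ unitaryGroupOfForm σ (!![H₂ 0 0, 0, H₂ 0 1; 0, h, 0; H₂ 1 0, 0, H₂ 1 1] : Matrix (Fin 3) (Fin 3) K))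
    (hu : Valued.v ((u : Matrix (Fin 1) (Fin 1) K) 0 0) = 1) {c : K} (hc : c ≠ 0) (hc1 : Valued.v c ≤ 1) (huc : Valued.v ((u : Matrix (Fin 1) (Fin 1) K) 0 0 - 1) ≤ Valued.v c) {R : ℕ}
    (hfin : {M : Submodule 𝒪[K] (Fin 3 → K) |
      IsSelfDualLattice σ ϖ (!![H₂ 0 0, 0, H₂ 0 1; 0, h, 0; H₂ 1 0, 0, H₂ 1 1] : Matrix (Fin 3) (Fin 3) K) M ∧ mapGL (endoGL (γ₂, u)) M = M}.Finite)
    (hR : ∀ M : Submodule 𝒪[K] (Fin 3 → K), IsSelfDualLattice σ ϖ (!![H₂ 0 0, 0, H₂ 0 1; 0, h, 0; H₂ 1 0, 0, H₂ 1 1] : Matrix (Fin 3) (Fin 3) K) M →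
      mapGL (endoGL (γ₂, u)) M = M → ∀ b : ℕ, (∀ a : K, (Pi.single 1 a : Fin 3 → K) ∈ M ↔ Valued.v a ≤ Valued.v ϖ ^ b) → b ≤ R) :
    {M : Submodule 𝒪[K] (Fin 3 → K) |
        IsSelfDualLattice σ ϖ (!![H₂ 0 0, 0, H₂ 0 1; 0, h, 0; H₂ 1 0, 0, H₂ 1 1] : Matrix (Fin 3) (Fin 3) K) M ∧ mapGL (endoGL (γ₂, u)) M = M ∧
          M.map ((Matrix.toLin' (((endoGL (γ₂, u) : GL (Fin 3) K) : Matrix (Fin 3) (Fin 3) K) - 1)).restrictScalars 𝒪[K]) ≤ scaleLattice c M}.ncard =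
      {B₂ : Submodule 𝒪[K] (Fin 2 → K) | IsSelfDualLattice σ ϖ H₂ B₂ ∧ mapGL γ₂ B₂ = B₂ ∧
          B₂.map ((Matrix.toLin' ((γ₂ : Matrix (Fin 2) (Fin 2) K) - 1)).restrictScalars 𝒪[K]) ≤ scaleLattice c B₂}.ncard +
        ∑ b ∈ Finset.Icc 1 R, ∑ᶠ B₂ ∈ {B : Submodule 𝒪[K] (Fin 2 → K) | (∃ g : GL (Fin 2) K, B = latt (g : Matrix (Fin 2) (Fin 2) K)) ∧ mapGL γ₂ B = B ∧
            (∀ y ∈ B, c⁻¹ • (((γ₂ : Matrix (Fin 2) (Fin 2) K) - 1) *ᵥ y) ∈ B) ∧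
            ∃ w₀ : Fin 2 → K, (∀ w, w ∈ B ↔ (w ∈ dualLatt σ H₂ B ∧ Valued.v (pairing σ H₂ w₀ w) ≤ 1)) ∧
              (∀ w ∈ dualLatt σ H₂ B, ∃ (t : K) (a : Fin 2 → K), Valued.v t ≤ 1 ∧ a ∈ B ∧ w = t • w₀ + a) ∧
              Valued.v (pairing σ H₂ w₀ w₀) * Valued.v ϖ ^ (2 * b) = 1 ∧
              c⁻¹ • ((γ₂ : Matrix (Fin 2) (Fin 2) K).mulVec w₀ - (u : Matrix (Fin 1) (Fin 1) K) 0 0 • w₀) ∈ B},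
          {M : Submodule 𝒪[K] (Fin 3 → K) | IsSelfDualLattice σ ϖ (!![H₂ 0 0, 0, H₂ 0 1; 0, h, 0; H₂ 1 0, 0, H₂ 1 1] : Matrix (Fin 3) (Fin 3) K) M ∧
              M ⊓ LinearMap.ker ((LinearMap.proj (1 : Fin 3) : (Fin 3 → K) →ₗ[K] K).restrictScalars 𝒪[K]) =
                B₂.map ((Matrix.toLin' (!![1, 0; 0, 0; 0, 1] : Matrix (Fin 3) (Fin 2) K)).restrictScalars 𝒪[K]) ∧
              ∀ a : K, (Pi.single 1 a : Fin 3 → K) ∈ M ↔ Valued.v a ≤ Valued.v ϖ ^ b}.ncard := by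
  classical
  have hϖv0 : Valued.v ϖ ≠ 0 := by rw [hϖ]; exact WithZero.coe_ne_zero
  have hϖ0 : ϖ ≠ 0 := fun h0 => hϖv0 (by rw [h0, map_zero])
  have hϖ1 : Valued.v ϖ ≤ 1 := by rw [hϖ, ← WithZero.exp_zero, WithZero.exp_le_exp]; norm_num
  -- the token in the `∀`-spelling, as a side condition `P`
  set P : Submodule 𝒪[K] (Fin 3 → K) → Prop := fun M =>
    mapGL (endoGL (γ₂, u)) M = M ∧ ∀ x ∈ M, (((endoGL (γ₂, u) : GL (Fin 3) K) : Matrix (Fin 3) (Fin 3) K) - 1) *ᵥ x ∈ scaleLattice c M with hP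
  have hLHS : {M : Submodule 𝒪[K] (Fin 3 → K) |
        IsSelfDualLattice σ ϖ (!![H₂ 0 0, 0, H₂ 0 1; 0, h, 0; H₂ 1 0, 0, H₂ 1 1] : Matrix (Fin 3) (Fin 3) K) M ∧ mapGL (endoGL (γ₂, u)) M = M ∧
          M.map ((Matrix.toLin' (((endoGL (γ₂, u) : GL (Fin 3) K) : Matrix (Fin 3) (Fin 3) K) - 1)).restrictScalars 𝒪[K]) ≤ scaleLattice c M} =
      {M | IsSelfDualLattice σ ϖ (!![H₂ 0 0, 0, H₂ 0 1; 0, h, 0; H₂ 1 0, 0, H₂ 1 1] : Matrix (Fin 3) (Fin 3) K) M ∧ P M} := by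
    ext M; simp only [Set.mem_setOf_eq, hP, map_toLin'_le_scaleLattice_iff_forall_mulVec_mem]
  have hfinP : {M : Submodule 𝒪[K] (Fin 3 → K) |
      IsSelfDualLattice σ ϖ (!![H₂ 0 0, 0, H₂ 0 1; 0, h, 0; H₂ 1 0, 0, H₂ 1 1] : Matrix (Fin 3) (Fin 3) K) M ∧ P M}.Finite :=
    hfin.subset fun M hM => ⟨hM.1, hM.2.1⟩
  have hRP : ∀ M : Submodule 𝒪[K] (Fin 3 → K), IsSelfDualLattice σ ϖ (!![H₂ 0 0, 0, H₂ 0 1; 0, h, 0; H₂ 1 0, 0, H₂ 1 1] : Matrix (Fin 3) (Fin 3) K) M → P M →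
      ∀ b : ℕ, (∀ a : K, (Pi.single 1 a : Fin 3 → K) ∈ M ↔ Valued.v a ≤ Valued.v ϖ ^ b) → b ≤ R := fun M hM hPM => hR M hM hPM.1
  rw [hLHS, ncard_selfDual_eq_ncard_axis_add_sum_finsum_ncard_glueFibre σ hvσ hϖ hH₂ hh P hfinP hRP]
  congr 1
  · -- the axis: ★ (z1-d) with one level token
    rw [← ncard_selfDual_fixed_axis_lev_eq σ hvσ hϖ0 hϖ1 hH₂ hh γ₂ hu hc huc]
    congr 1
    ext M
    simp only [Set.mem_setOf_eq, hP, map_toLin'_le_scaleLattice_iff_forall_mulVec_mem]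
    tauto
  · refine Finset.sum_congr rfl fun b hb => ?_
    have h := finsum_ncard_levGlueCell_eq_finsum_mem_ncard_glueFibre σ hσ hvσ hϖ hH₂ hH₂σ hh γ₂ u hΓ hu hc hc1 huc hfin (Finset.mem_Icc.1 hb).1
    simp only [hP]
    exact h

end Summit.HodgeConjecture.HodgeConjecture.Cruxes.H413.F0P3cDyRamBlockGlueLevelCount

end
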